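import Literature.MathematicalPhysics.QuantumFieldTheory.Balaban1983to89.T3PrintedRegularMinimiser
import Literature.MathematicalPhysics.QuantumFieldTheory.Balaban1983to89.T3SectALandauChart
import Literature.MathematicalPhysics.QuantumFieldTheory.Balaban1983to89.B8Lemma1NonAbelian
import HarnessLib

/-!
# Prop. 7 on T³ — lane II (P-box): THE PLAQUETTE DATA OF THE BOX PULL-BACK FROM `RegPr`

Route `UnitScaleTilt`, crux `MinimiserStabilityRegPr` (stmt-QuantumFields-19200), EX lane, hN06 LANE II; cell `ym3-torus`, width seat `ym3-torus-px12` (gen 8).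
THEOREMS ONLY (0 `def`, 0 `sorry`); `--supports stmt-QuantumFields-19200 --as helper`, count-neutral.  YM₃ on T³ is ladder rung R3 — not d = 4, not infinite volume,
not a mass gap, not the Clay problem; nothing here claims a stub, the crux or the gap.

THE POINT.  The lane-II member readings of the `ℤᵈ` box bricks — (B8-member) `Prop7BoxLocalPotentialMember.boxLocalPotential_member`, w4 g11's h4
`…BoxLocalResidualMember`, px9 g7's (a′), px5 g7's §6 — all DISPLAY lit ✓`B8Lemma1NonAbelian.PlaqSmall V (z − R) (z + R) α` for the pull-back connection
`V w μ := W♮⟨transl c w, μ⟩` of the member background `W`.  For a printed-regular `W ∈ 𝔘_k(ε)` (lit ✓`T3PrintedRegularMinimiser.RegPr` = `PlaqSmall (regThreshold F n K ε) W ∧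
DivSmall`, threshold `regThreshold F n K ε = ε·L^{−2(K−n)}`), that hypothesis holds on EVERY interval `[lo, hi]` with `α := regThreshold F n K ε`: the pull-back's plaquette
variable at `(w; κ, μ)` is the torus plaquette variable of `W` at `transl c w` (lit ✓`B10Eq27TorusAxialLog.hol_pull`), whose distance to `1` in `M₂(ℂ)` is `dist1 (plaqHol W p)`
(lit ✓`norm_holT_unitsField_plaqWord_sub_one`; the reversed orientation is the inverse of a unitary, lit ✓`holT_plaqWord_swap` + ✓`B7Prop1Explicit.norm_inv_sub_one_le`).

* `plaqSmall_pull_of_regPr` — `RegPr F n K ε W → PlaqSmall (pull (unitsField (toUField W)) c) lo hi (regThreshold F n K ε)`;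
* `plaqSmall_of_regPr_of_eq_transl` — the same in the consumers' letters `(V) (hV : ∀ w μ, V w μ = unitsField (toUField W) ⟨transl c w, μ⟩)`;
* `plaqSmall_of_regPr_of_eq_transl_of_le` — with any `α ≥ regThreshold F n K ε`.
HONEST SCOPE.  A dictionary row; the windows `hw`-type (`64d³·2R³(2R+1)α² ≤ 1` …) stay the consumer's; nothing of (REC)∕hN06∕the crux is proved here.

References: T. Bałaban, CMP 99 (1985) 75–102 [Balaban1985RegularSpaces] ((1.7) p.77); CMP 102 (1985) 277–309 [Balaban1985Variational] ((2) p.278); CMP 98 (1985) 17–51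
[Balaban1985Averaging] ((9) pp.18–19, (19)–(20) p.21).
-/

set_option autoImplicit false

noncomputable section

open scoped Matrix.Norms.L2Operator

namespace Summit.QuantumFields.YangMills.Theorems.Prop7BoxPullbackPlaqSmall

open Literature.MathematicalPhysics.QuantumFieldTheory.Balaban1983to89
open Literature.MathematicalPhysics.QuantumFieldTheory.Balaban1983to89.T3ContinuumYM3Torus
open T3PrintedRegularMinimiser (RegPr RegPr.plaqSmall)
open T3RegularMinimiser (regThreshold)
open B7Prop1Explicit (hol plaqWord)
open B7Prop2Explicit (unitaryUnits unitaryUnits_le_U1 hol_mem_of)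
open B10Eq27TorusAxialLog (transl holT unitsField toUField pull pull_apply hol_pull hol_pull_zero holT_plaqWord_swap unitsField_mem_unitaryUnits
  norm_holT_unitsField_plaqWord_sub_one)

variable (F : T3Family) (n K : ℕ)

/-- **(P-box) THE PULL-BACK OF A PRINTED-REGULAR BACKGROUND HAS SMALL PLAQUETTES ON EVERY BOX**: for `W ∈ 𝔘_k(ε)` and any chart centre `c`, every unit plaquette of
`pull W♮ c` (both orientations) is within `regThreshold F n K ε = ε·L^{−2(K−n)}` of `1` in `M₂(ℂ)`, on any interval `[lo, hi] ⊂ ℤᵈ`.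
[cite: Balaban1985RegularSpaces, (1.7) p.77; Balaban1985Averaging, (9) p.19 and (19)-(20) p.21] -/
theorem plaqSmall_pull_of_regPr {ε : ℝ} {W : GaugeField (F.P K) 0 (Matrix.specialUnitaryGroup (Fin 2) ℂ)} (hreg : RegPr F n K ε W)
    (c : Site (F.P K) 0) (lo hi : B7Prop1Explicit.Site (F.P K).d) :
    B8Lemma1NonAbelian.PlaqSmall (pull (unitsField (toUField W)) c) lo hi (regThreshold F n K ε) := by
  letI : CStarAlgebra (Matrix (Fin 2) (Fin 2) ℂ) := B10Eq29TubeLine.cstarAlgebraMatrix 2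
  intro x κ μ hκμ _ _
  rw [hol_pull]
  rcases lt_or_gt_of_ne hκμ with hlt | hgt
  · rw [norm_holT_unitsField_plaqWord_sub_one _ _ hlt]
    exact (hreg.plaqSmall _).le
  · have hmem : holT (unitsField (toUField W)) (transl c x) (plaqWord μ κ) ∈ unitaryUnits (Matrix (Fin 2) (Fin 2) ℂ) := by
      rw [← hol_pull_zero]
      exact hol_mem_of (V := pull (unitsField (toUField W)) (transl c x)) (fun _ _ => unitsField_mem_unitaryUnits (toUField W) _) 0 _
    rw [holT_plaqWord_swap]
    exact (B7Prop1Explicit.norm_inv_sub_one_le (unitaryUnits_le_U1 hmem)).trans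
      (by rw [norm_holT_unitsField_plaqWord_sub_one _ _ hgt]; exact (hreg.plaqSmall _).le)

/-- **(P-box) IN THE CONSUMERS' LETTERS**: a connection `V` on `ℤᵈ` that reads `W♮` along the chart `w ↦ transl c w` (the `hV` of (B8-member), h4, (a′), §6) has small
plaquettes on every interval with `α := regThreshold F n K ε` when `W ∈ 𝔘_k(ε)`. [cite: Balaban1985RegularSpaces, (1.7) p.77; Balaban1985Averaging, (9) p.18] -/
theorem plaqSmall_of_regPr_of_eq_transl {ε : ℝ} {W : GaugeField (F.P K) 0 (Matrix.specialUnitaryGroup (Fin 2) ℂ)} (hreg : RegPr F n K ε W)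
    (c : Site (F.P K) 0) (V : B7Prop1Explicit.Site (F.P K).d → Fin (F.P K).d → (Matrix (Fin 2) (Fin 2) ℂ)ˣ)
    (hV : ∀ w μ, V w μ = unitsField (toUField W) ⟨transl c w, μ⟩) (lo hi : B7Prop1Explicit.Site (F.P K).d) :
    B8Lemma1NonAbelian.PlaqSmall V lo hi (regThreshold F n K ε) := by
  have hVp : V = pull (unitsField (toUField W)) c := by
    funext w μ; rw [hV, pull_apply]
  rw [hVp]
  exact plaqSmall_pull_of_regPr F n K hreg c lo hi

/-- **(P-box) WITH A WEAKER BOUND**: any `α ≥ regThreshold F n K ε` serves (lit ✓`PlaqSmall.of_le`). [cite: Balaban1985RegularSpaces, (1.7) p.77] -/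
theorem plaqSmall_of_regPr_of_eq_transl_of_le {ε α : ℝ} {W : GaugeField (F.P K) 0 (Matrix.specialUnitaryGroup (Fin 2) ℂ)} (hreg : RegPr F n K ε W)
    (hα : regThreshold F n K ε ≤ α) (c : Site (F.P K) 0) (V : B7Prop1Explicit.Site (F.P K).d → Fin (F.P K).d → (Matrix (Fin 2) (Fin 2) ℂ)ˣ)
    (hV : ∀ w μ, V w μ = unitsField (toUField W) ⟨transl c w, μ⟩) (lo hi : B7Prop1Explicit.Site (F.P K).d) :
    B8Lemma1NonAbelian.PlaqSmall V lo hi α :=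
  (plaqSmall_of_regPr_of_eq_transl F n K hreg c V hV lo hi).of_le hα

/-- **THE THRESHOLD IN THE MEMBER'S `η`-LETTERS**: `regThreshold F n K ε = ε·η²` with `η = eta F n K = L^{−(K−n)}` (definitional bookkeeping for the windows).
[cite: Balaban1985Variational, (2) p.278] -/
theorem regThreshold_eq_mul_eta_sq (ε : ℝ) : regThreshold F n K ε = ε * (T3SectALandauChart.eta F n K) ^ 2 := by
  rw [regThreshold, T3SectALandauChart.eta, ← pow_mul, mul_comm 2]

end Summit.QuantumFields.YangMills.Theorems.Prop7BoxPullbackPlaqSmall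

end
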